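import Summits.RiemannHypothesis.RiemannHypothesis.Theses.LiCoefficients
import Literature.NumberTheory.LFunctions.KeiperLiPositivityUpTo
import HarnessLib

/-!
# RiemannHypothesis / LiCoefficients — item `Assembly` (RH-FREE)

Route `RiemannHypothesis/LiCoefficients` (cell `pub/rh-li`, D-0059/D-0061): `Assembly := LiBoxSplit → LiWindowLowerBound →
LiFarZeroTail → LiHeightBudget → LiTheory.LiHeightLawQuadratic`.  Proof = the theory seat's `AssemblyProof.lean`
(rh-li-theory gen 3): for `n ≤ 2π(T − 4)` the tree's linear law `keiperLiCoeff_nonneg_of_riemannHypothesisUpTo`; otherwise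
`T₂ = min(T, n/13) ≥ 1100`, `B = log T/(6πT³)` from `LiFarZeroTail`, the box split, the window bound and the budget.
RH-FREE [rh-li-prover]; nothing here bears on the truth of RH.  (The leaf itself is already the landed theorem
`LiTheory.liHeightLawQuadratic_holds`, `LiCoefficientsLiHeightLaw.lean`.)
-/

noncomputable section

-- D-0017: `Summit.<S>.<S>.…` is the designed namespace of a single-problem summit.
set_option linter.dupNamespace false

namespace Summit.RiemannHypothesis.RiemannHypothesis.Theorems.LiTheory

/-- **Item `Assembly` of route `LiCoefficients` — PROVED.** -/
theorem assembly_proof : Summit.RiemannHypothesis.RiemannHypothesis.Theses.LiCoefficients.Assembly := by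
  intro h5 h4 h3 h6 T hT hRH n hn hnc
  have hπ := Real.pi_gt_three
  have hπ4 := Real.pi_lt_d2
  have hT5 : (10 : ℝ) ^ 5 ≤ T := hT
  have hT0 : (0 : ℝ) < T := by linarith [hT5, show (0:ℝ) < 10 ^ 5 by norm_num]
  by_cases hlin : (n : ℝ) ≤ 2 * Real.pi * (T - 4)
  · exact Literature.NumberTheory.LFunctions.keiperLiCoeff_nonneg_of_riemannHypothesisUpTo hRH hn hlin
  rw [not_le] at hlin
  set T₂ : ℝ := min T (n / 13) with hT₂
  have hn_big : (14300 : ℝ) ≤ n := by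
    have : 2 * Real.pi * (T - 4) ≥ 2 * 3 * ((10 : ℝ) ^ 5 - 4) := by nlinarith
    norm_num at this; linarith
  have hT₂_ge : (1100 : ℝ) ≤ T₂ := by
    rw [hT₂, le_min_iff]; constructor
    · linarith [hT5, show (1100 : ℝ) ≤ 10 ^ 5 by norm_num]
    · rw [le_div_iff₀ (by norm_num : (0 : ℝ) < 13)]; linarith
  have hT₂_le : T₂ ≤ T := min_le_left _ _
  have hnc4 : (n : ℝ) ≤ T ^ 2 / 4 := hnc.trans (by nlinarith [sq_nonneg T])
  have hB : ∀ U : ℝ, T ≤ U →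
      ∑ ρ ∈ Literature.NumberTheory.LFunctions.SchoenfeldBound.zerosBetween T U,
        (Literature.NumberTheory.LFunctions.riemannZetaZeroOrder ρ : ℝ) / ρ.im ^ 4 ≤
        Real.log T / (6 * Real.pi * T ^ 3) :=
    fun U hU ↦ h3 T U (by linarith [hT5, show (1000 : ℝ) ≤ 10 ^ 5 by norm_num]) hU
  have hsplit := h5 n T T₂ (Real.log T / (6 * Real.pi * T ^ 3)) hRH hT₂_ge hT₂_le hn hnc4 hB
  have hwin := h4 n T₂ hn hT₂_ge
  have hbud := h6 n T hT5 hlin hnc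
  linarith

end Summit.RiemannHypothesis.RiemannHypothesis.Theorems.LiTheory

end
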